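import Summits.QuantumFields.BalabanUV.Beta.GAN24.StripLegVectorsRatio
import Summits.QuantumFields.BalabanUV.Beta.GAN24.StripLegUnitsJM

/-!
# `BalabanUV.Beta.GAN24.StripLegUnitsJMRatio` — binder row G-an2-4 ∕ (CONV-C), lineage gan24-p3 (part P3, Woodbury ∕ fibre layer):
# **(U2) AT RELATIVE BLOCKING `Lc^m` WITH A CONSTANT POLYNOMIAL IN `Lc^m`** — road P1's `StripLegReadout.sum_packSrc_inl_le`, `StripLegUnits.ff∕fm∕mf_sq_le` and
# `StripLegUnitsJM.norm_kFibW_jm_sq_le_cstSq` re-run on the ratio-sharp leg vectors of `GAN24/StripLegVectorsRatio` (layer 1): the squared a-priori constant becomes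
# `cstSqR A η (Lc^m) r₀` = `StripLegUnits.cstSq` with `exp(η·(4·Lc^m))` REPLACED BY `exp(4η)` — the only `Lc^m`-dependence left is the polynomial one
# (`(Lc^m)^12` under the square root)

NOT IN PRINT; OUR PROOF ([folklore] bookkeeping; every estimate is road P1's, re-instantiated).  HONEST FRAMING (cell contract, verbatim): «discharging `BetaPertH`
makes Bałaban's UV stability UNCONDITIONAL — a real constructive-QFT result; it is NOT the continuum limit and NOT the Clay problem.»  HONEST DEPENDENCY (verbatim):
«continuum YM on T⁴ ⇐ BetaPertH ∧ nine spine estimates (0/9 proved); BetaPertH ⇐ (D1) ∧ (D4) ∧ CAP+tail; G-an2-4 gates asym, D1 and NE2/3/4.»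

WHY (located item «KPERF-TAIL-AMP», census `HOME/b2b-balaban-gan24-p3/WOODBURY-FIBRE.md` v9.1 row V19): `GAN24/KPerfTailRate.decays_KPerf_uniformRate` has the `n`-free RATE
`δ₀∕n` but the AMPLITUDE `cstU … (Lc^m) … · e^{2κ}` with `cstSq ∋ exp(κ·4·Lc^m)^4`, exponential in `n = Lc^m`.  At a box representative `z` of the relative blocking
(`0 ≤ z_i < Lc^m`) the sharp offset factor of layer 1 is `exp(η·(Lc^j∕Lc^(j+m))·Σ_i z_i) ≤ exp(4η)` (`exp_offset_repZ_le_ratio`), so the four leg bounds close with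
`E := exp(4η)`.  LAYERS 2–3 of the re-run; layer 4 (`FibreStripJMHolds.legBound_jm_of_inv_bound` ∕ `KPerfTailRate.stripRegularKM_uniform` with `cstSqR`) follows.

CONTENT (all [folklore]; §1–§2 generic `d`, §3–§4 `d = 3`):
* §1 `sum_packSrc_inl_le_ratio` — the field source sum with the sharp factor `e_R(y′) = exp(η·(M∕N)·Σ|y′_i|)`.
* §2 `reading_le_ratio`, `ff_sq_le_ratio`, `fm_sq_le_ratio`, `mf_sq_le_ratio` — road P1's four-minus-one squared leg bounds with the sharp factors (mm has none).
* §3 `cstSqR A η R r₀` (`E = exp(4η)`), `cstSqR_nonneg`, `term1∕2∕3∕4_le_cstSqR`, `cstSqR_mono`; `exp_offset_repZ_le_ratio`.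
* §4 **`norm_kFibW_jm_sq_le_cstSqR`** ∕ `norm_kFibW_jm_le_sqrt_cstSqR`: (U2) at `(N, M) = (Lc^(j+m), Lc^j)` with the constant `cstSqR A η (Lc^m) r₀` — `j`-FREE and
  with NO exponential in `Lc^m`.
0 wall binders; nothing of (CONV-C) discharged; NEVER «G-an2-4 closed», NOT N7c, NOT D1, NOT BetaPertH, NOT continuum, NOT Clay.

ABSOLUTE RULE (cell, verbatim): «No internally-minted statement may enter as a cited fact. Every hypothesis is either kernel-proved in this package or a
verbatim quotation of a PUBLISHED theorem with page reference.»  Nothing is cited; ONE data `def` (`cstSqR`, an explicit real constant); every input is a tree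
theorem imported BY NAME.
-/

noncomputable section

open Complex Finset Matrix
open scoped BigOperators Real
open Literature.Probability.LatticeModels (TorusSite Torus.proj)
open Literature.MathematicalPhysics.QuantumFieldTheory
open Literature.MathematicalPhysics.QuantumFieldTheory.LatticeForm (quo repZ)
open Literature.MathematicalPhysics.QuantumFieldTheory.Balaban1983to89
open Literature.MathematicalPhysics.QuantumFieldTheory.Balaban1983to89.Beta
open AffineAveraging (Site)
open BlochFibreMatrix (repZ_nonneg repZ_lt)
open FibreInverseDecay (cphase)
open OneStepResolventKernel (Fib)
open Summit.QuantumFields.BalabanUV.Beta.GAN24.CombesThomas (sfStep smStep)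
open Summit.QuantumFields.BalabanUV.Beta.GAN24.CombesThomasFibreStep (kFibW cphase_zero_left)
open Summit.QuantumFields.BalabanUV.Beta.GAN24.ArrowOperator (AIdx arrowMat aliasArrow packSrc)
open Summit.QuantumFields.BalabanUV.Beta.GAN24.KFibClosedForm (legCoef)
open Summit.QuantumFields.BalabanUV.Beta.GAN24.KFibLegSource (legSrcVec)
open Summit.QuantumFields.BalabanUV.Beta.GAN24.StripLegReadout
  (norm_kFibW_inl_sq_le norm_kFibW_inr_sq_le sum_packSrc_inr_le packSrc_legSrcVec_inl sum_packSrc_inl_eq)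
open Summit.QuantumFields.BalabanUV.Beta.GAN24.StripLegVectorsRatio (sum_norm_readW_sq_le_strip_ratio sum_weighted_norm_srcW_sq_le_strip_ratio)
open Summit.QuantumFields.BalabanUV.Beta.GAN24.StripLegUnits (mm_sq_le lc_pos pow_pos')
open Summit.QuantumFields.BalabanUV.Beta.GAN24.StripLegUnitsJM (pow_le_pow_add quo_pow_add_smul_repZ unit_ff_m unit_fm_m unit_mf_m unit_mm_m)

namespace Summit.QuantumFields.BalabanUV.Beta.GAN24.StripLegUnitsJMRatio

/-! ## §1 The field source sum with the sharp factor (generic `d`) -/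

section Readout

variable {d N : ℕ} [NeZero N] {p : Fin (d + 1) → ℂ} {η : ℝ} {M : ℕ} {sf sm : ℝ}
variable {σ ρ : AIdx (d + 1) (TorusSite (d + 1) N) → ℝ} {A Sφ R0 RE RQ : ℝ}

/-- [folklore] THE FIELD SOURCE SUM under the row-weight bounds, sharp factor:
`Σ_i (ρ_i‖(packSrc p (legSrcVec … (inl l) …))_i‖)² ≤ sf²·N^{−2D}·e_R(y′)²·6^{D+1}(N∕M)^{2D}·(R0² + RE²(5^D−1))`, `e_R(y′) = exp(η·(M∕N)·Σ|y′_i|)`. -/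
theorem sum_packSrc_inl_le_ratio (him : ∀ i, |(p i).im| ≤ η) (hre : ∀ i, |(p i).re| ≤ π) (hη : 0 ≤ η) (hη4 : η ≤ 1 / 4)
    (hM : 0 < M) (hMN : M ≤ N) (l : Fin (d + 1)) (y' : Site (d + 1))
    (hρ0 : |ρ (Sum.inl (Sum.inl l, 0))| ≤ R0) (hρE : ∀ m, m ≠ 0 → |ρ (Sum.inl (Sum.inl l, m))| ≤ RE) :
    ∑ i, (ρ i * ‖packSrc p (legSrcVec N M p (legCoef M sf sm (Sum.inl l : Fib d)) (Sum.inl l) y') i‖) ^ 2 ≤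
      sf ^ 2 * ((((N : ℝ) ^ (d + 1)) ^ 2)⁻¹ *
        (Real.exp (η * ((M : ℝ) / N) * ∑ i, |(y' i : ℝ)|) ^ 2 * ((6 : ℝ) ^ (d + 1 + 1) * (((N : ℝ) / M) ^ 2) ^ (d + 1)) *
          (R0 ^ 2 + RE ^ 2 * ((5 : ℝ) ^ (d + 1) - 1)))) := by
  rw [packSrc_legSrcVec_inl, sum_packSrc_inl_eq]
  refine mul_le_mul_of_nonneg_left ?_ (sq_nonneg _)
  have hN : (0 : ℝ) < (N : ℝ) ^ (d + 1) := pow_pos (by exact_mod_cast Nat.pos_of_ne_zero (NeZero.ne N)) _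
  have hsum := sum_weighted_norm_srcW_sq_le_strip_ratio (D := d + 1) him hre hη hη4 hM hMN l y' (fun m => |ρ (Sum.inl (Sum.inl l, m))|)
    (fun m hm => ⟨abs_nonneg _, hρE m hm⟩)
  have hrew : ∀ m : TorusSite (d + 1) N, ρ (Sum.inl (Sum.inl l, m)) ^ 2 * ‖AliasObjects.srcW N M p m l y'‖ ^ 2 =
      (((N : ℝ) ^ (d + 1)) ^ 2)⁻¹ * (|ρ (Sum.inl (Sum.inl l, m))| ^ 2 * ‖(N : ℂ) ^ (d + 1) * AliasObjects.srcW N M p m l y'‖ ^ 2) := by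
    intro m
    rw [norm_mul, norm_pow, Complex.norm_natCast, mul_pow, sq_abs]
    field_simp
  rw [Finset.sum_congr rfl fun m _ => hrew m, ← Finset.mul_sum]
  refine mul_le_mul_of_nonneg_left (hsum.trans ?_) (by positivity)
  have h0 : |ρ (Sum.inl (Sum.inl l, 0))| ^ 2 ≤ R0 ^ 2 := pow_le_pow_left₀ (abs_nonneg _) hρ0 2
  have h5 : (0 : ℝ) ≤ (5 : ℝ) ^ (d + 1) - 1 := by
    have : (1 : ℝ) ≤ (5 : ℝ) ^ (d + 1) := one_le_pow₀ (by norm_num)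
    linarith
  gcongr

/-! ## §2 The leg bounds with the sharp factors (generic `d`) -/

/-- [folklore] The reading `ℓ²`-sum bound with the unit, sharp factor. -/
theorem reading_le_ratio (him : ∀ i, |(p i).im| ≤ η) (hre : ∀ i, |(p i).re| ≤ π) (hη : 0 ≤ η) (hη4 : η ≤ 1 / 4) (hM : 0 < M) (hMN : M ≤ N)
    (κ : Fin (d + 1)) (x' : Site (d + 1)) :
    sf ^ 2 * ∑ m : TorusSite (d + 1) N, ‖AliasObjects.readW N M p m κ x'‖ ^ 2 ≤
      sf ^ 2 * (Real.exp (η * ((M : ℝ) / N) * ∑ i, |(x' i : ℝ)|) ^ 2 * ((6 : ℝ) ^ (d + 1 + 1) * ((((N : ℝ) / M) ^ 2) ^ (d + 1) * (5 : ℝ) ^ (d + 1)))) :=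
  mul_le_mul_of_nonneg_left (sum_norm_readW_sq_le_strip_ratio (D := d + 1) him hre hη hη4 hM hMN κ x') (sq_nonneg _)

/-- [folklore] **ff**, sharp factors. -/
theorem ff_sq_le_ratio (him : ∀ i, |(p i).im| ≤ η) (hre : ∀ i, |(p i).re| ≤ π) (hη : 0 ≤ η) (hη4 : η ≤ 1 / 4) (hM : 0 < M) (hMN : M ≤ N)
    (hσ : ∀ i, 0 < σ i) (hσA : ∀ m κ, σ (Sum.inl (Sum.inl κ, m)) ≤ 1)
    (hAP : ∀ x, ∑ i, (‖x i‖ / σ i) ^ 2 ≤ A ^ 2 * ∑ i, (ρ i * ‖(arrowMat (aliasArrow N p) *ᵥ x) i‖) ^ 2)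
    (κ : Fin (d + 1)) (x' : Site (d + 1)) (l : Fin (d + 1)) (y' : Site (d + 1))
    (hρ0 : |ρ (Sum.inl (Sum.inl l, 0))| ≤ R0) (hρE : ∀ m, m ≠ 0 → |ρ (Sum.inl (Sum.inl l, m))| ≤ RE) :
    ‖kFibW N M sf sm (Sum.inl κ) x' (Sum.inl l) y' p‖ ^ 2 ≤
      (sf ^ 2 * (Real.exp (η * ((M : ℝ) / N) * ∑ i, |(x' i : ℝ)|) ^ 2 * ((6 : ℝ) ^ (d + 1 + 1) * ((((N : ℝ) / M) ^ 2) ^ (d + 1) * (5 : ℝ) ^ (d + 1))))) *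
        (A ^ 2 * (sf ^ 2 * ((((N : ℝ) ^ (d + 1)) ^ 2)⁻¹ *
          (Real.exp (η * ((M : ℝ) / N) * ∑ i, |(y' i : ℝ)|) ^ 2 * ((6 : ℝ) ^ (d + 1 + 1) * (((N : ℝ) / M) ^ 2) ^ (d + 1)) *
            (R0 ^ 2 + RE ^ 2 * ((5 : ℝ) ^ (d + 1) - 1)))))) := by
  refine (norm_kFibW_inl_sq_le hσ hσA hAP κ x' (Sum.inl l) y').trans ?_
  exact mul_le_mul (reading_le_ratio him hre hη hη4 hM hMN κ x')
    (mul_le_mul_of_nonneg_left (sum_packSrc_inl_le_ratio him hre hη hη4 hM hMN l y' hρ0 hρE) (sq_nonneg _))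
    (mul_nonneg (sq_nonneg _) (Finset.sum_nonneg fun _ _ => sq_nonneg _)) (by positivity)

/-- [folklore] **fm**, sharp factor. -/
theorem fm_sq_le_ratio (him : ∀ i, |(p i).im| ≤ η) (hre : ∀ i, |(p i).re| ≤ π) (hη : 0 ≤ η) (hη4 : η ≤ 1 / 4) (hM : 0 < M) (hMN : M ≤ N)
    (hσ : ∀ i, 0 < σ i) (hσA : ∀ m κ, σ (Sum.inl (Sum.inl κ, m)) ≤ 1) (hRQ : 0 ≤ RQ) (hsm : 0 ≤ sm)
    (hAP : ∀ x, ∑ i, (‖x i‖ / σ i) ^ 2 ≤ A ^ 2 * ∑ i, (ρ i * ‖(arrowMat (aliasArrow N p) *ᵥ x) i‖) ^ 2)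
    (κ : Fin (d + 1)) (x' : Site (d + 1)) (l : Fin (d + 1)) (y' : Site (d + 1)) (hρQ : |ρ (Sum.inr (Sum.inl l))| ≤ RQ) :
    ‖kFibW N M sf sm (Sum.inl κ) x' (Sum.inr l) y' p‖ ^ 2 ≤
      (sf ^ 2 * (Real.exp (η * ((M : ℝ) / N) * ∑ i, |(x' i : ℝ)|) ^ 2 * ((6 : ℝ) ^ (d + 1 + 1) * ((((N : ℝ) / M) ^ 2) ^ (d + 1) * (5 : ℝ) ^ (d + 1))))) *
        (A ^ 2 * (RQ * sm * ‖cphase (-quo N ((M : ℤ) • y')) p‖) ^ 2) := by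
  refine (norm_kFibW_inl_sq_le hσ hσA hAP κ x' (Sum.inr l) y').trans ?_
  exact mul_le_mul (reading_le_ratio him hre hη hη4 hM hMN κ x')
    (mul_le_mul_of_nonneg_left (sum_packSrc_inr_le hRQ hsm l y' hρQ) (sq_nonneg _))
    (mul_nonneg (sq_nonneg _) (Finset.sum_nonneg fun _ _ => sq_nonneg _)) (by positivity)

/-- [folklore] **mf**, sharp factor. -/
theorem mf_sq_le_ratio (him : ∀ i, |(p i).im| ≤ η) (hre : ∀ i, |(p i).re| ≤ π) (hη : 0 ≤ η) (hη4 : η ≤ 1 / 4) (hM : 0 < M) (hMN : M ≤ N)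
    (hσ : ∀ i, 0 < σ i) (hσφ : ∀ κ, σ (Sum.inr (Sum.inl κ)) ≤ Sφ) (hsm : 0 ≤ sm)
    (hAP : ∀ x, ∑ i, (‖x i‖ / σ i) ^ 2 ≤ A ^ 2 * ∑ i, (ρ i * ‖(arrowMat (aliasArrow N p) *ᵥ x) i‖) ^ 2)
    (κ : Fin (d + 1)) (x' : Site (d + 1)) (l : Fin (d + 1)) (y' : Site (d + 1))
    (hρ0 : |ρ (Sum.inl (Sum.inl l, 0))| ≤ R0) (hρE : ∀ m, m ≠ 0 → |ρ (Sum.inl (Sum.inl l, m))| ≤ RE) :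
    ‖kFibW N M sf sm (Sum.inr κ) x' (Sum.inl l) y' p‖ ^ 2 ≤
      (Sφ * sm * ‖cphase (quo N ((M : ℤ) • x')) p‖) ^ 2 *
        (A ^ 2 * (sf ^ 2 * ((((N : ℝ) ^ (d + 1)) ^ 2)⁻¹ *
          (Real.exp (η * ((M : ℝ) / N) * ∑ i, |(y' i : ℝ)|) ^ 2 * ((6 : ℝ) ^ (d + 1 + 1) * (((N : ℝ) / M) ^ 2) ^ (d + 1)) *
            (R0 ^ 2 + RE ^ 2 * ((5 : ℝ) ^ (d + 1) - 1)))))) := by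
  refine (norm_kFibW_inr_sq_le hσ hσφ hsm hAP κ x' (Sum.inl l) y').trans ?_
  exact mul_le_mul_of_nonneg_left (mul_le_mul_of_nonneg_left (sum_packSrc_inl_le_ratio him hre hη hη4 hM hMN l y' hρ0 hρE) (sq_nonneg _))
    (sq_nonneg _)

end Readout

/-! ## §3 The squared constant without the exponential in the relative blocking -/

section Constant

/-- [our object] THE `R`-POLYNOMIAL SQUARED (U2) CONSTANT (`d = 3`): `StripLegUnits.cstSq A η R r₀` with `exp(η·(4·R))` replaced by `E = exp(4η)`:
`cstSqR A η R r₀ = A²·(E⁴·6¹⁰·5⁴·R¹²·(r₀⁻⁴ + 39) + E²·6⁵·5⁴·R⁻² + E²·6⁵·(1 + 39·r₀⁴)·R⁻² + r₀⁴·R⁻¹⁶)`. -/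
def cstSqR (A η : ℝ) (R : ℕ) (r₀ : ℝ) : ℝ :=
  A ^ 2 * (Real.exp (η * 4) ^ 4 * ((6 : ℝ) ^ 10 * (5 : ℝ) ^ 4 * (R : ℝ) ^ 12) * (r₀⁻¹ ^ 4 + 39)
    + Real.exp (η * 4) ^ 2 * ((6 : ℝ) ^ 5 * (5 : ℝ) ^ 4) * ((R : ℝ) ^ 2)⁻¹
    + Real.exp (η * 4) ^ 2 * (6 : ℝ) ^ 5 * (1 + 39 * r₀ ^ 4) * ((R : ℝ) ^ 2)⁻¹
    + r₀ ^ 4 * ((R : ℝ) ^ 16)⁻¹)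

/-- [folklore] `0 ≤ cstSqR`. -/
theorem cstSqR_nonneg (A η : ℝ) (R : ℕ) (r₀ : ℝ) : 0 ≤ cstSqR A η R r₀ := by
  unfold cstSqR; positivity

/-- [folklore] The ff term is below `cstSqR`. -/
theorem term1_le_cstSqR (A η : ℝ) (R : ℕ) (r₀ : ℝ) :
    A ^ 2 * (Real.exp (η * 4) ^ 4 * ((6 : ℝ) ^ 10 * (5 : ℝ) ^ 4 * (R : ℝ) ^ 12) * (r₀⁻¹ ^ 4 + 39)) ≤ cstSqR A η R r₀ := by
  unfold cstSqR
  have h2 : 0 ≤ Real.exp (η * 4) ^ 2 * ((6 : ℝ) ^ 5 * (5 : ℝ) ^ 4) * ((R : ℝ) ^ 2)⁻¹ := by positivity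
  have h3 : 0 ≤ Real.exp (η * 4) ^ 2 * (6 : ℝ) ^ 5 * (1 + 39 * r₀ ^ 4) * ((R : ℝ) ^ 2)⁻¹ := by positivity
  have h4 : 0 ≤ r₀ ^ 4 * ((R : ℝ) ^ 16)⁻¹ := by positivity
  nlinarith [sq_nonneg A]

/-- [folklore] The fm term is below `cstSqR`. -/
theorem term2_le_cstSqR (A η : ℝ) (R : ℕ) (r₀ : ℝ) :
    A ^ 2 * (Real.exp (η * 4) ^ 2 * ((6 : ℝ) ^ 5 * (5 : ℝ) ^ 4) * ((R : ℝ) ^ 2)⁻¹) ≤ cstSqR A η R r₀ := by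
  unfold cstSqR
  have h1 : 0 ≤ Real.exp (η * 4) ^ 4 * ((6 : ℝ) ^ 10 * (5 : ℝ) ^ 4 * (R : ℝ) ^ 12) * (r₀⁻¹ ^ 4 + 39) := by positivity
  have h3 : 0 ≤ Real.exp (η * 4) ^ 2 * (6 : ℝ) ^ 5 * (1 + 39 * r₀ ^ 4) * ((R : ℝ) ^ 2)⁻¹ := by positivity
  have h4 : 0 ≤ r₀ ^ 4 * ((R : ℝ) ^ 16)⁻¹ := by positivity
  nlinarith [sq_nonneg A]

/-- [folklore] The mf term is below `cstSqR`. -/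
theorem term3_le_cstSqR (A η : ℝ) (R : ℕ) (r₀ : ℝ) :
    A ^ 2 * (Real.exp (η * 4) ^ 2 * (6 : ℝ) ^ 5 * (1 + 39 * r₀ ^ 4) * ((R : ℝ) ^ 2)⁻¹) ≤ cstSqR A η R r₀ := by
  unfold cstSqR
  have h1 : 0 ≤ Real.exp (η * 4) ^ 4 * ((6 : ℝ) ^ 10 * (5 : ℝ) ^ 4 * (R : ℝ) ^ 12) * (r₀⁻¹ ^ 4 + 39) := by positivity
  have h2 : 0 ≤ Real.exp (η * 4) ^ 2 * ((6 : ℝ) ^ 5 * (5 : ℝ) ^ 4) * ((R : ℝ) ^ 2)⁻¹ := by positivity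
  have h4 : 0 ≤ r₀ ^ 4 * ((R : ℝ) ^ 16)⁻¹ := by positivity
  nlinarith [sq_nonneg A]

/-- [folklore] The mm term is below `cstSqR`. -/
theorem term4_le_cstSqR (A η : ℝ) (R : ℕ) (r₀ : ℝ) : A ^ 2 * (r₀ ^ 4 * ((R : ℝ) ^ 16)⁻¹) ≤ cstSqR A η R r₀ := by
  unfold cstSqR
  have h1 : 0 ≤ Real.exp (η * 4) ^ 4 * ((6 : ℝ) ^ 10 * (5 : ℝ) ^ 4 * (R : ℝ) ^ 12) * (r₀⁻¹ ^ 4 + 39) := by positivity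
  have h2 : 0 ≤ Real.exp (η * 4) ^ 2 * ((6 : ℝ) ^ 5 * (5 : ℝ) ^ 4) * ((R : ℝ) ^ 2)⁻¹ := by positivity
  have h3 : 0 ≤ Real.exp (η * 4) ^ 2 * (6 : ℝ) ^ 5 * (1 + 39 * r₀ ^ 4) * ((R : ℝ) ^ 2)⁻¹ := by positivity
  nlinarith [sq_nonneg A]

/-- [folklore] MONOTONE ENVELOPE IN THE ZERO-ALIAS RADIUS: for `0 < ρ₁ ≤ r₀ ≤ ρ₂`,
`cstSqR A η R r₀ ≤ A²·(E⁴·…·R¹²·(ρ₁⁻⁴ + 39) + E²·6⁵·5⁴·R⁻² + E²·6⁵·(1 + 39·ρ₂⁴)·R⁻² + ρ₂⁴·R⁻¹⁶)`. -/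
theorem cstSqR_mono {A η ρ₁ ρ₂ r₀ : ℝ} {R : ℕ} (hρ₁ : 0 < ρ₁) (h1 : ρ₁ ≤ r₀) (h2 : r₀ ≤ ρ₂) :
    cstSqR A η R r₀ ≤
      A ^ 2 * (Real.exp (η * 4) ^ 4 * ((6 : ℝ) ^ 10 * (5 : ℝ) ^ 4 * (R : ℝ) ^ 12) * (ρ₁⁻¹ ^ 4 + 39)
        + Real.exp (η * 4) ^ 2 * ((6 : ℝ) ^ 5 * (5 : ℝ) ^ 4) * ((R : ℝ) ^ 2)⁻¹
        + Real.exp (η * 4) ^ 2 * (6 : ℝ) ^ 5 * (1 + 39 * ρ₂ ^ 4) * ((R : ℝ) ^ 2)⁻¹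
        + ρ₂ ^ 4 * ((R : ℝ) ^ 16)⁻¹) := by
  have hr : 0 < r₀ := lt_of_lt_of_le hρ₁ h1
  have hinv : r₀⁻¹ ≤ ρ₁⁻¹ := by rw [inv_le_inv₀ hr hρ₁]; exact h1
  have hinv0 : 0 ≤ r₀⁻¹ := inv_nonneg.2 hr.le
  unfold cstSqR
  gcongr

variable {Lc : ℕ} [NeZero Lc]

/-- [folklore] **AT A BOX REPRESENTATIVE OF THE RELATIVE BLOCKING THE SHARP OFFSET FACTOR IS `exp(4η)`**: for `z ∈ (ℤ∕Lc^m)^4` (`0 ≤ z_i < Lc^m`) and `0 ≤ η`,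
`exp(η·(Lc^m)⁻¹·Σ_i |z_i|) ≤ exp(4η)`. -/
theorem exp_offset_repZ_le_ratio {η : ℝ} (hη : 0 ≤ η) (m : ℕ) (z : TorusSite 4 (Lc ^ m)) :
    Real.exp (η * ((Lc : ℝ) ^ m)⁻¹ * ∑ i, |((repZ z i : ℤ) : ℝ)|) ≤ Real.exp (η * 4) := by
  have hL : (0 : ℝ) < (Lc : ℝ) ^ m := pow_pos lc_pos m
  refine Real.exp_le_exp.2 ?_
  rw [mul_assoc]
  refine mul_le_mul_of_nonneg_left ?_ hη
  have hsum : ∑ i, |((repZ z i : ℤ) : ℝ)| ≤ 4 * (Lc : ℝ) ^ m := by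
    calc ∑ i, |((repZ z i : ℤ) : ℝ)| ≤ ∑ _i : Fin 4, (Lc : ℝ) ^ m := by
          refine Finset.sum_le_sum fun i _ => ?_
          rw [abs_of_nonneg (by exact_mod_cast repZ_nonneg z i)]
          have h := (repZ_lt z i).le
          have h' : ((repZ z i : ℤ) : ℝ) ≤ ((Lc ^ m : ℕ) : ℝ) := by exact_mod_cast h
          rw [Nat.cast_pow] at h'
          exact h'
      _ = 4 * (Lc : ℝ) ^ m := by simp
  calc ((Lc : ℝ) ^ m)⁻¹ * ∑ i, |((repZ z i : ℤ) : ℝ)| ≤ ((Lc : ℝ) ^ m)⁻¹ * (4 * (Lc : ℝ) ^ m) :=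
        mul_le_mul_of_nonneg_left hsum (inv_nonneg.2 hL.le)
    _ = 4 := by field_simp

end Constant

/-! ## §4 (U2) at relative blocking `Lc^m` with the polynomial constant -/

section Main

variable {Lc : ℕ} [NeZero Lc] {η A r₀ : ℝ}

/-- **(U2) AT RELATIVE BLOCKING `Lc^m`, SQUARED, WITH THE CONSTANT `cstSqR A η (Lc^m) r₀`** [our proof] (`d = 3`): the statement of
`StripLegUnitsJM.norm_kFibW_jm_sq_le_cstSq` VERBATIM with `cstSq` replaced by `cstSqR` — same hypotheses (the cut's slot ∕ row weights at blocking `N = Lc^(j+m)`, the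
scaled a-priori bound with constant `A`), same proof with the sharp offset factors `≤ exp(4η)`. -/
theorem norm_kFibW_jm_sq_le_cstSqR (hη : 0 ≤ η) (hη4 : η ≤ 1 / 4) (hr₀ : 0 < r₀) (m j : ℕ) {p : Fin 4 → ℂ}
    (him : ∀ i, |(p i).im| ≤ η) (hre : ∀ i, |(p i).re| ≤ π)
    (σ ρ : AIdx 4 (TorusSite 4 (Lc ^ (j + m))) → ℝ) (hσ : ∀ i, 0 < σ i)
    (hσA : ∀ n κ, σ (Sum.inl (Sum.inl κ, n)) ≤ 1)
    (hσφ : ∀ κ, σ (Sum.inr (Sum.inl κ)) ≤ r₀ ^ 2 / ((Lc : ℝ) ^ (j + m)) ^ 3)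
    (hρ0 : ∀ κ, |ρ (Sum.inl (Sum.inl κ, 0))| ≤ ((Lc : ℝ) ^ (j + m)) ^ 2 / r₀ ^ 2)
    (hρE : ∀ n, n ≠ 0 → ∀ κ, |ρ (Sum.inl (Sum.inl κ, n))| ≤ ((Lc : ℝ) ^ (j + m)) ^ 2 / 4)
    (hρQ : ∀ κ, |ρ (Sum.inr (Sum.inl κ))| ≤ (((Lc : ℝ) ^ (j + m)) ^ 5)⁻¹)
    (hAP : ∀ x, ∑ i, (‖x i‖ / σ i) ^ 2 ≤ A ^ 2 * ∑ i, (ρ i * ‖(arrowMat (aliasArrow (Lc ^ (j + m)) p) *ᵥ x) i‖) ^ 2)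
    (a b : Fib 3) (zx zy : TorusSite 4 (Lc ^ m)) :
    ‖kFibW (Lc ^ (j + m)) (Lc ^ j) (sfStep Lc j) (smStep 3 Lc j) a (repZ zx) b (repZ zy) p‖ ^ 2 ≤ cstSqR A η (Lc ^ m) r₀ := by
  have hl : (0 : ℝ) < Lc := lc_pos
  have hl0 : (Lc : ℝ) ≠ 0 := hl.ne'
  have hr0 : r₀ ≠ 0 := hr₀.ne'
  have hM : 0 < Lc ^ j := pow_pos' j
  have hMN : Lc ^ j ≤ Lc ^ (j + m) := pow_le_pow_add j m
  have hNR : ((Lc ^ (j + m) : ℕ) : ℝ) = (Lc : ℝ) ^ (j + m) := Nat.cast_pow Lc (j + m)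
  have hLR : ((Lc ^ m : ℕ) : ℝ) = (Lc : ℝ) ^ m := Nat.cast_pow Lc m
  have hratio : ((Lc ^ (j + m) : ℕ) : ℝ) / ((Lc ^ j : ℕ) : ℝ) = (Lc : ℝ) ^ m := by
    rw [Nat.cast_pow, Nat.cast_pow, pow_add, mul_div_cancel_left₀ _ (pow_ne_zero _ hl0)]
  have hratioInv : ((Lc ^ j : ℕ) : ℝ) / ((Lc ^ (j + m) : ℕ) : ℝ) = ((Lc : ℝ) ^ m)⁻¹ := by
    rw [Nat.cast_pow, Nat.cast_pow, pow_add, div_mul_eq_div_div, div_self (pow_ne_zero _ hl0), one_div]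
  have hsf : sfStep Lc j = (Lc : ℝ) ^ j := rfl
  have hsm : smStep 3 Lc j = (Lc : ℝ) ^ (j * 4) := rfl
  have hsm0 : 0 ≤ smStep 3 Lc j := by rw [hsm]; positivity
  have hφx : cphase (quo (Lc ^ (j + m)) (((Lc ^ j : ℕ) : ℤ) • repZ zx)) p = 1 := by rw [quo_pow_add_smul_repZ, cphase_zero_left]
  have hφy : cphase (-quo (Lc ^ (j + m)) (((Lc ^ j : ℕ) : ℤ) • repZ zy)) p = 1 := by
    rw [quo_pow_add_smul_repZ, neg_zero, cphase_zero_left]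
  have hex := exp_offset_repZ_le_ratio (Lc := Lc) hη m zx
  have hey := exp_offset_repZ_le_ratio (Lc := Lc) hη m zy
  have t1 := term1_le_cstSqR A η (Lc ^ m) r₀
  have t2 := term2_le_cstSqR A η (Lc ^ m) r₀
  have t3 := term3_le_cstSqR A η (Lc ^ m) r₀
  have t4 := term4_le_cstSqR A η (Lc ^ m) r₀
  rw [hLR] at t1 t2 t3 t4
  rcases a with κ | κ <;> rcases b with l' | l'
  · -- ff
    have h := ff_sq_le_ratio (N := Lc ^ (j + m)) (M := Lc ^ j) (sf := sfStep Lc j) (sm := smStep 3 Lc j) him hre hη hη4 hM hMN hσ hσA hAP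
      κ (repZ zx) l' (repZ zy) (hρ0 l') (fun n hn => hρE n hn l')
    rw [hratioInv, hratio, hNR, hsf] at h
    set ex : ℝ := Real.exp (η * ((Lc : ℝ) ^ m)⁻¹ * ∑ i, |((repZ zx i : ℤ) : ℝ)|) with hexd
    set ey : ℝ := Real.exp (η * ((Lc : ℝ) ^ m)⁻¹ * ∑ i, |((repZ zy i : ℤ) : ℝ)|) with heyd
    set E : ℝ := Real.exp (η * 4) with hE
    set l : ℝ := (Lc : ℝ) with hldef
    calc _ ≤ _ := h
      _ = A ^ 2 * ((l ^ j) ^ 2 * (l ^ j) ^ 2 * (((l ^ (j + m)) ^ (3 + 1)) ^ 2)⁻¹ *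
              (((l ^ (j + m)) ^ 2 / r₀ ^ 2) ^ 2 + ((l ^ (j + m)) ^ 2 / 4) ^ 2 * ((5 : ℝ) ^ (3 + 1) - 1))) *
            (ex ^ 2 * ey ^ 2 * ((6 : ℝ) ^ (3 + 1 + 1) * (((l ^ m) ^ 2) ^ (3 + 1) * (5 : ℝ) ^ (3 + 1))) *
              ((6 : ℝ) ^ (3 + 1 + 1) * ((l ^ m) ^ 2) ^ (3 + 1))) := by
          ring
      _ ≤ A ^ 2 * ((r₀⁻¹ ^ 4 + 39) * ((l ^ m) ^ 4)⁻¹) *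
            (E ^ 2 * E ^ 2 * ((6 : ℝ) ^ (3 + 1 + 1) * (((l ^ m) ^ 2) ^ (3 + 1) * (5 : ℝ) ^ (3 + 1))) *
              ((6 : ℝ) ^ (3 + 1 + 1) * ((l ^ m) ^ 2) ^ (3 + 1))) := by
          rw [unit_ff_m hl0 hr0 j m]
          gcongr
      _ = A ^ 2 * (E ^ 4 * ((6 : ℝ) ^ 10 * (5 : ℝ) ^ 4 * (l ^ m) ^ 12) * (r₀⁻¹ ^ 4 + 39)) := by
          field_simp
          ring
      _ ≤ cstSqR A η (Lc ^ m) r₀ := t1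
  · -- fm
    have h := fm_sq_le_ratio (N := Lc ^ (j + m)) (M := Lc ^ j) (sf := sfStep Lc j) (sm := smStep 3 Lc j) him hre hη hη4 hM hMN hσ hσA
      (by positivity) hsm0 hAP κ (repZ zx) l' (repZ zy) (hρQ l')
    rw [hratioInv, hratio, hsf, hsm, hφy, norm_one, mul_one] at h
    set ex : ℝ := Real.exp (η * ((Lc : ℝ) ^ m)⁻¹ * ∑ i, |((repZ zx i : ℤ) : ℝ)|) with hexd
    set E : ℝ := Real.exp (η * 4) with hE
    set l : ℝ := (Lc : ℝ) with hldef
    calc _ ≤ _ := h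
      _ = A ^ 2 * ((l ^ j) ^ 2 * ((((l ^ (j + m)) ^ 5)⁻¹ * l ^ (j * 4)) ^ 2)) *
            (ex ^ 2 * ((6 : ℝ) ^ (3 + 1 + 1) * (((l ^ m) ^ 2) ^ (3 + 1) * (5 : ℝ) ^ (3 + 1)))) := by ring
      _ ≤ A ^ 2 * ((l ^ m) ^ 10)⁻¹ * (E ^ 2 * ((6 : ℝ) ^ (3 + 1 + 1) * (((l ^ m) ^ 2) ^ (3 + 1) * (5 : ℝ) ^ (3 + 1)))) := by
          rw [unit_fm_m hl0 j m]
          gcongr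
      _ = A ^ 2 * (E ^ 2 * ((6 : ℝ) ^ 5 * (5 : ℝ) ^ 4) * ((l ^ m) ^ 2)⁻¹) := by
          field_simp
          ring
      _ ≤ cstSqR A η (Lc ^ m) r₀ := t2
  · -- mf
    have h := mf_sq_le_ratio (N := Lc ^ (j + m)) (M := Lc ^ j) (sf := sfStep Lc j) (sm := smStep 3 Lc j) him hre hη hη4 hM hMN hσ hσφ hsm0 hAP
      κ (repZ zx) l' (repZ zy) (hρ0 l') (fun n hn => hρE n hn l')
    rw [hratioInv, hratio, hNR, hsf, hsm, hφx, norm_one, mul_one] at h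
    set ey : ℝ := Real.exp (η * ((Lc : ℝ) ^ m)⁻¹ * ∑ i, |((repZ zy i : ℤ) : ℝ)|) with heyd
    set E : ℝ := Real.exp (η * 4) with hE
    set l : ℝ := (Lc : ℝ) with hldef
    calc _ ≤ _ := h
      _ = A ^ 2 * ((r₀ ^ 2 / (l ^ (j + m)) ^ 3 * l ^ (j * 4)) ^ 2 * ((l ^ j) ^ 2 * (((l ^ (j + m)) ^ (3 + 1)) ^ 2)⁻¹ *
              (((l ^ (j + m)) ^ 2 / r₀ ^ 2) ^ 2 + ((l ^ (j + m)) ^ 2 / 4) ^ 2 * ((5 : ℝ) ^ (3 + 1) - 1)))) *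
            (ey ^ 2 * ((6 : ℝ) ^ (3 + 1 + 1) * ((l ^ m) ^ 2) ^ (3 + 1))) := by ring
      _ ≤ A ^ 2 * ((1 + 39 * r₀ ^ 4) * ((l ^ m) ^ 10)⁻¹) * (E ^ 2 * ((6 : ℝ) ^ (3 + 1 + 1) * ((l ^ m) ^ 2) ^ (3 + 1))) := by
          rw [unit_mf_m hl0 hr0 j m]
          gcongr
      _ = A ^ 2 * (E ^ 2 * (6 : ℝ) ^ 5 * (1 + 39 * r₀ ^ 4) * ((l ^ m) ^ 2)⁻¹) := by
          field_simp
          ring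
      _ ≤ cstSqR A η (Lc ^ m) r₀ := t3
  · -- mm
    have h := mm_sq_le (N := Lc ^ (j + m)) (M := Lc ^ j) (sf := sfStep Lc j) (sm := smStep 3 Lc j) (p := p) hσ hσφ (by positivity) hsm0 hAP
      κ (repZ zx) l' (repZ zy) (hρQ l')
    rw [hsm, hφx, hφy, norm_one, mul_one, mul_one] at h
    set l : ℝ := (Lc : ℝ) with hldef
    calc _ ≤ _ := h
      _ = A ^ 2 * ((r₀ ^ 2 / (l ^ (j + m)) ^ 3 * l ^ (j * 4)) ^ 2 * ((((l ^ (j + m)) ^ 5)⁻¹ * l ^ (j * 4)) ^ 2)) := by ring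
      _ = A ^ 2 * (r₀ ^ 4 * ((l ^ m) ^ 16)⁻¹) := by rw [unit_mm_m hl0 j m]
      _ ≤ cstSqR A η (Lc ^ m) r₀ := t4

/-- [our proof] **(U2) AT RELATIVE BLOCKING `Lc^m`, un-squared, polynomial constant**:
`‖kFibW (Lc^(j+m)) (Lc^j) (sfStep Lc j) (smStep 3 Lc j) a (repZ zx) b (repZ zy) p‖ ≤ √(cstSqR A η (Lc^m) r₀)`. -/
theorem norm_kFibW_jm_le_sqrt_cstSqR (hη : 0 ≤ η) (hη4 : η ≤ 1 / 4) (hr₀ : 0 < r₀) (m j : ℕ) {p : Fin 4 → ℂ}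
    (him : ∀ i, |(p i).im| ≤ η) (hre : ∀ i, |(p i).re| ≤ π)
    (σ ρ : AIdx 4 (TorusSite 4 (Lc ^ (j + m))) → ℝ) (hσ : ∀ i, 0 < σ i)
    (hσA : ∀ n κ, σ (Sum.inl (Sum.inl κ, n)) ≤ 1)
    (hσφ : ∀ κ, σ (Sum.inr (Sum.inl κ)) ≤ r₀ ^ 2 / ((Lc : ℝ) ^ (j + m)) ^ 3)
    (hρ0 : ∀ κ, |ρ (Sum.inl (Sum.inl κ, 0))| ≤ ((Lc : ℝ) ^ (j + m)) ^ 2 / r₀ ^ 2)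
    (hρE : ∀ n, n ≠ 0 → ∀ κ, |ρ (Sum.inl (Sum.inl κ, n))| ≤ ((Lc : ℝ) ^ (j + m)) ^ 2 / 4)
    (hρQ : ∀ κ, |ρ (Sum.inr (Sum.inl κ))| ≤ (((Lc : ℝ) ^ (j + m)) ^ 5)⁻¹)
    (hAP : ∀ x, ∑ i, (‖x i‖ / σ i) ^ 2 ≤ A ^ 2 * ∑ i, (ρ i * ‖(arrowMat (aliasArrow (Lc ^ (j + m)) p) *ᵥ x) i‖) ^ 2)
    (a b : Fib 3) (zx zy : TorusSite 4 (Lc ^ m)) :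
    ‖kFibW (Lc ^ (j + m)) (Lc ^ j) (sfStep Lc j) (smStep 3 Lc j) a (repZ zx) b (repZ zy) p‖ ≤ Real.sqrt (cstSqR A η (Lc ^ m) r₀) :=
  Real.le_sqrt_of_sq_le (norm_kFibW_jm_sq_le_cstSqR hη hη4 hr₀ m j him hre σ ρ hσ hσA hσφ hρ0 hρE hρQ hAP a b zx zy)

end Main

end Summit.QuantumFields.BalabanUV.Beta.GAN24.StripLegUnitsJMRatio

end
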